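import Summits.QuantumFields.YangMills.Theorems.ColdStartUniversalityLatticeLangevinErgodicAverage
import Summits.QuantumFields.YangMills.Theorems.ColdStartUniversalityLatticeLangevinLiebRobinsonMixingTime
import HarnessLib

/-!
# Route `ColdStartUniversality` (fixed-cut-off SZZ dynamics): ★★★ VOLUME-FREE TIME-LIKE DECORRELATION AND MEAN-SQUARE ERGODIC THEOREM
# FOR LOCAL OBSERVABLES AT STRONG COUPLING `|β'| < 1/12`

Helper file (seat `ym-line-csu-p1`, g33; `--supports stmt-QuantumFields-24809`).  Files 48–49 (time-like decorrelation `Ce^(−ct)` and the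
mean-square ergodic theorem `4C/(cT)` for the cold-start Langevin sampler) carry Harris constants `C, c` depending on the volume.  For LOCAL
observables `f∘coords` (`C⁵` with a link-Lipschitz profile `ℓ` supported in a finite link set `Λ`) at `|β'| < 1/12` the every-start mixing is
volume-free (g29/g30: `wilson_local_mixing_halfRate_of_linkLipschitz`, constant `C_f = 12π·#Λ·√(Σℓ²)·(6(7+6λ/ρ)³+2)`, rate `ρ/2`,
`ρ = 1 − 12|β'|`, `λ = (1300+4√2)|β'|`), so the Markov property (file 44) gives, for EVERY strong solution from a deterministic start on ANY
space (in particular the cold start) and EVERY torus size `L`: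
* ★ `abs_twoTime_centered_le_of_transition_bound` — generic: a uniform bound `|κ_tG(y) − m| ≤ ε` (every `y`) and `|F| ≤ B` give
  `|E[F(U_s)·(G(U_(s+t)) − m)]| ≤ B·ε`;
* ★★★ `abs_twoTime_centered_le_uniform_of_linkLipschitz` — `|E[F(U_s)·(f(U_(s+t)) − μ_(β')f)]| ≤ B·C_f·e^(−ρt/2)` for every bounded measurable `F`
  (any support, even global), uniformly in `s`, the start AND THE VOLUME;
* ★★★ `integral_sq_timeAverage_sub_wilson_le_uniform_of_linkLipschitz` — **`E[(T⁻¹∫₀ᵀ f(U_r) dr − μ_(β')(f))²] ≤ 8·M·C_f/(ρ·T)`** (`|f∘coords| ≤ M`,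
  jointly measurable solution): the cold-start Langevin estimate of a local observable has mean-square error `O(1/(ρT))` INDEPENDENT OF THE
  VOLUME at strong coupling.
THEOREMS ONLY, no definition, no sorry; [folklore].  HONEST FRAMING: fixed cut-off, fixed `|β'| < 1/12` (the route's scaling `β'_K → ∞` leaves this
window); `UniformColdStartMixing` (24809) is NOT restated; no crux, rung or summit statement is proved; the Yang–Mills mass gap is NOT proved.
-/

set_option autoImplicit false

noncomputable section

namespace Summit.QuantumFields.YangMills.Theorems.ColdStartUniversality.LiebRobinson

open MeasureTheory ProbabilityTheory Matrix Complex Finset Filter Set Metric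
open scoped ComplexConjugate BigOperators Matrix NNReal ENNReal Topology
open Literature.Probability.Process Literature.MathematicalPhysics.QuantumFieldTheory
open Literature.MathematicalPhysics.QuantumFieldTheory.Balaban1983to89
open Literature.MathematicalPhysics.QuantumLattice (fundamentalRep fundamentalLatticeRep continuous_fundamentalRep fundamentalRep_apply)

variable {L : ℕ} [NeZero L]

/-! ## §1. Generic: a uniform mixing bound for `G` gives two-time decorrelation against any bounded `F` -/

/-- ★ **Two-time decorrelation from a uniform mixing bound.**  If `|∫ G dκ_t(y) − m| ≤ ε` for every `y` and `|F| ≤ B`, then along every strong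
solution from a deterministic start `|E[F(U_s)·(G(U_(s+t)) − m)]| ≤ B·ε` (Markov property, file 44). [folklore] -/
theorem abs_twoTime_centered_le_of_transition_bound (β' : ℝ)
    (κ : ℝ≥0 → Kernel (GaugeConfig 3 L (Matrix.specialUnitaryGroup (Fin 2) ℂ))
      (GaugeConfig 3 L (Matrix.specialUnitaryGroup (Fin 2) ℂ))) [∀ t, IsMarkovKernel (κ t)]
    (hreal : ∀ (t : ℝ≥0) (x : GaugeConfig 3 L (Matrix.specialUnitaryGroup (Fin 2) ℂ))
        (Ω : Type) [MeasurableSpace Ω] (P : Measure Ω) [IsProbabilityMeasure P]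
        (W : ℝ≥0 → Ω → (Edge 3 L × NoiseIdx 2 → ℝ)) (hW : IsFlatBrownian W P)
        (U : ℝ≥0 → Ω → GaugeConfig 3 L (Matrix.specialUnitaryGroup (Fin 2) ℂ)),
        (∀ ω, U 0 ω = x) →
        (latticeLangevinDynamics (fundamentalLatticeRep 2) β').IsSolution (fundamentalRep (Fin 2))
          hW.natFiltration P W U →
        κ t x = P.map (U t))
    (x : GaugeConfig 3 L (Matrix.specialUnitaryGroup (Fin 2) ℂ))
    {Ω : Type} [MeasurableSpace Ω] {P : Measure Ω} [IsProbabilityMeasure P]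
    {W : ℝ≥0 → Ω → (Edge 3 L × NoiseIdx 2 → ℝ)} (hW : IsFlatBrownian W P)
    {U : ℝ≥0 → Ω → GaugeConfig 3 L (Matrix.specialUnitaryGroup (Fin 2) ℂ)} (hU0 : ∀ ω, U 0 ω = x)
    (hU : (latticeLangevinDynamics (fundamentalLatticeRep 2) β').IsSolution (fundamentalRep (Fin 2)) hW.natFiltration P W U)
    (s t : ℝ≥0) {F : GaugeConfig 3 L (Matrix.specialUnitaryGroup (Fin 2) ℂ) → ℝ} (hF : Measurable F) {B : ℝ} (hFb : ∀ z, |F z| ≤ B)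
    {G : GaugeConfig 3 L (Matrix.specialUnitaryGroup (Fin 2) ℂ) → ℝ} (hG : Measurable G) {CG : ℝ} (hGb : ∀ z, |G z| ≤ CG)
    (m ε : ℝ) (hmix : ∀ y, |(∫ z, G z ∂(κ t y)) - m| ≤ ε) :
    |∫ ω, F (U s ω) * (G (U (s + t) ω) - m) ∂P| ≤ B * ε := by
  classical
  have hmU : ∀ u : ℝ≥0, Measurable (U u) := fun u => (hU.adapted u).mono (hW.natFiltration.le u) le_rfl
  have hZ : Measurable[hW.natFiltration s] fun ω => F (U s ω) := hF.comp (hU.adapted s)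
  have hM := integral_mul_comp_add_eq_integral_mul_transition β' κ hreal x hW hU0 hU s t hZ (fun ω => hFb _) hG hGb
  have hκGm : Measurable fun y => ∫ z, G z ∂(κ t y) := (hG.stronglyMeasurable.integral_kernel (κ := κ t)).measurable
  have hκGb : ∀ y, |∫ z, G z ∂(κ t y)| ≤ CG := fun y => by
    have hh := norm_integral_le_of_norm_le_const (μ := κ t y) (f := G) (C := CG)
      (Eventually.of_forall fun z => by simpa [Real.norm_eq_abs] using hGb z)
    simpa [Real.norm_eq_abs] using hh
  have hB0 : ∀ ω, 0 ≤ B := fun ω => (abs_nonneg _).trans (hFb (U s ω))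
  have hInt : ∀ {φ : Ω → ℝ} {C : ℝ}, Measurable φ → (∀ ω, |φ ω| ≤ C) → Integrable (fun ω => F (U s ω) * φ ω) P := fun hφ hφb =>
    (integrable_const _).mono' ((hF.comp (hmU s)).mul hφ).aestronglyMeasurable (Eventually.of_forall fun ω => by
      rw [norm_mul, Real.norm_eq_abs, Real.norm_eq_abs]; exact mul_le_mul (hFb _) (hφb ω) (abs_nonneg _) (hB0 ω))
  have i1 : Integrable (fun ω => F (U s ω) * G (U (s + t) ω)) P := hInt (hG.comp (hmU _)) (fun ω => hGb _)
  have i2 : Integrable (fun ω => F (U s ω) * m) P := hInt measurable_const (fun _ => le_rfl)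
  have i3 : Integrable (fun ω => F (U s ω) * ∫ z, G z ∂(κ t (U s ω))) P := hInt (hκGm.comp (hmU s)) (fun ω => hκGb _)
  have heq : ∫ ω, F (U s ω) * (G (U (s + t) ω) - m) ∂P = ∫ ω, F (U s ω) * ((∫ z, G z ∂(κ t (U s ω))) - m) ∂P := by
    have e1 : ∫ ω, F (U s ω) * (G (U (s + t) ω) - m) ∂P = (∫ ω, F (U s ω) * G (U (s + t) ω) ∂P) - ∫ ω, F (U s ω) * m ∂P := by
      rw [← integral_sub i1 i2]; exact integral_congr_ae (ae_of_all _ fun ω => by ring)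
    have e2 : ∫ ω, F (U s ω) * ((∫ z, G z ∂(κ t (U s ω))) - m) ∂P = (∫ ω, F (U s ω) * ∫ z, G z ∂(κ t (U s ω)) ∂P) - ∫ ω, F (U s ω) * m ∂P := by
      rw [← integral_sub i3 i2]; exact integral_congr_ae (ae_of_all _ fun ω => by ring)
    rw [e1, e2, hM]
  rw [heq]
  have hpt : ∀ ω, |F (U s ω) * ((∫ z, G z ∂(κ t (U s ω))) - m)| ≤ B * ε := fun ω => by
    rw [abs_mul]; exact mul_le_mul (hFb _) (hmix _) (abs_nonneg _) (hB0 ω)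
  have hh := norm_integral_le_of_norm_le_const (μ := P) (f := fun ω => F (U s ω) * ((∫ z, G z ∂(κ t (U s ω))) - m)) (C := B * ε)
    (Eventually.of_forall fun ω => by rw [Real.norm_eq_abs]; exact hpt ω)
  simpa [Real.norm_eq_abs] using hh

/-! ## §2. Local observables at `|β'| < 1/12`: volume-free two-time decorrelation -/

/-- ★★★ **Volume-free time-like decorrelation for local observables at strong coupling.**  At `|β'| < 1/12`, for every torus size `L`, every
strong solution `U` from a deterministic start on any space, every bounded measurable `F` with `|F| ≤ B`, every `C⁵` local observable `f` with
link-Lipschitz profile `ℓ ≥ 0` supported in `Λ`, and all `s, t`: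
`|E[F(U_s)·(f∘coords(U_(s+t)) − μ_(β')(f∘coords))]| ≤ B·12π·#Λ·√(Σℓ²)·(6(7+6λ/ρ)³+2)·e^(−ρt/2)` — no volume factor. [folklore] -/
theorem abs_twoTime_centered_le_uniform_of_linkLipschitz (L : ℕ) [NeZero L] (β' : ℝ) (hβ : |β'| < 1 / 12)
    (x : GaugeConfig 3 L (Matrix.specialUnitaryGroup (Fin 2) ℂ))
    {Ω : Type} [MeasurableSpace Ω] {P : Measure Ω} [IsProbabilityMeasure P]
    {W : ℝ≥0 → Ω → (Edge 3 L × NoiseIdx 2 → ℝ)} (hW : IsFlatBrownian W P)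
    {U : ℝ≥0 → Ω → GaugeConfig 3 L (Matrix.specialUnitaryGroup (Fin 2) ℂ)} (hU0 : ∀ ω, U 0 ω = x)
    (hU : (latticeLangevinDynamics (fundamentalLatticeRep 2) β').IsSolution (fundamentalRep (Fin 2)) hW.natFiltration P W U)
    {F : GaugeConfig 3 L (Matrix.specialUnitaryGroup (Fin 2) ℂ) → ℝ} (hF : Measurable F) {B : ℝ} (hFb : ∀ z, |F z| ≤ B)
    {f : (Edge 3 L × Fin 2 × Fin 2 × Bool → ℝ) → ℝ} (hf : ContDiff ℝ 5 f) (Λ : Finset (Edge 3 L)) {ℓ : Edge 3 L → ℝ} (hℓ : ∀ e, 0 ≤ ℓ e)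
    (hℓΛ : ∀ e, e ∉ Λ → ℓ e = 0) (s t : ℝ≥0) :
    let coords : GaugeConfig 3 L (Matrix.specialUnitaryGroup (Fin 2) ℂ) → (Edge 3 L × Fin 2 × Fin 2 × Bool → ℝ) :=
      fun V q => (fun z : ℂ => if q.2.2.2 then z.im else z.re)
        ((fundamentalRep (Fin 2) (V q.1) : Matrix (Fin 2) (Fin 2) ℂ) q.2.1 q.2.2.1)
    (∀ (e : Edge 3 L) (y y' : (GaugeConfig 3 L (Matrix.specialUnitaryGroup (Fin 2) ℂ))), (∀ g, g ≠ e → y g = y' g) →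
      |f (coords y) - f (coords y')| ≤ ℓ e * frobNorm ((y e : Matrix (Fin 2) (Fin 2) ℂ) - (y' e : Matrix (Fin 2) (Fin 2) ℂ))) →
    |∫ ω, F (U s ω) * (f (coords (U (s + t) ω)) - ∫ y, f (coords y) ∂(wilsonMeasure (d := 3) (L := L) (fundamentalRep (Fin 2)) β')) ∂P| ≤
      B * (12 * Real.pi * Λ.card * Real.sqrt (∑ e : Edge 3 L, ℓ e ^ 2) * (6 * (7 + 6 * ((1300 + 4 * Real.sqrt 2) * |β'|) / (1 - 12 * |β'|)) ^ 3 + 2) *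
        Real.exp (-((1 - 12 * |β'|) / 2 * (t : ℝ)))) := by
  intro coords hLip
  classical
  haveI := secondCountableTopology_su2
  haveI := borelSpace_config L
  obtain ⟨κ, hκM, -, hreal⟩ := exists_transitionKernel L β'
  haveI := hκM
  have hco : Continuous coords := continuous_coords (L := L)
  have hGc : Continuous fun y : (GaugeConfig 3 L (Matrix.specialUnitaryGroup (Fin 2) ℂ)) => f (coords y) := hf.continuous.comp hco
  obtain ⟨CG, hCG⟩ : ∃ C : ℝ, ∀ y : (GaugeConfig 3 L (Matrix.specialUnitaryGroup (Fin 2) ℂ)), |f (coords y)| ≤ C := by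
    set Gb := BoundedContinuousFunction.mkOfCompact ⟨fun y => f (coords y), hGc⟩ with hGbdef
    exact ⟨‖Gb‖, fun y => by simpa [hGbdef, Real.norm_eq_abs] using Gb.norm_coe_le_norm y⟩
  have hmix := wilson_local_mixing_halfRate_of_linkLipschitz L β' hβ κ hreal hf Λ hℓ hℓΛ t hLip
  exact abs_twoTime_centered_le_of_transition_bound β' κ hreal x hW hU0 hU s t hF hFb hGc.measurable hCG _ _ hmix

/-! ## §3. Local observables at `|β'| < 1/12`: the volume-free mean-square ergodic theorem -/

/-- ★★★ **VOLUME-FREE MEAN-SQUARE ERGODIC THEOREM for local observables at strong coupling.**  At `|β'| < 1/12`, for every torus size `L`, every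
jointly measurable strong solution `U` from a deterministic start on any space (e.g. the cold start), every `C⁵` local observable `f` with
link-Lipschitz profile `ℓ ≥ 0` supported in `Λ` and `|f∘coords| ≤ M`, and every `T > 0`:
`E[(T⁻¹ ∫_(0,T] f∘coords(U_r) dr − μ_(β')(f∘coords))²] ≤ 8·M·C_f/(ρ·T)`, `C_f = 12π·#Λ·√(Σℓ²)·(6(7+6λ/ρ)³+2)`, `ρ = 1 − 12|β'|` — the Langevin
estimate of a local observable has mean-square error `O(1/(ρT))` independently of the volume. [folklore] -/
theorem integral_sq_timeAverage_sub_wilson_le_uniform_of_linkLipschitz (L : ℕ) [NeZero L] (β' : ℝ) (hβ : |β'| < 1 / 12)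
    (x : GaugeConfig 3 L (Matrix.specialUnitaryGroup (Fin 2) ℂ))
    {Ω : Type} [MeasurableSpace Ω] {P : Measure Ω} [IsProbabilityMeasure P]
    {W : ℝ≥0 → Ω → (Edge 3 L × NoiseIdx 2 → ℝ)} (hW : IsFlatBrownian W P)
    {U : ℝ≥0 → Ω → GaugeConfig 3 L (Matrix.specialUnitaryGroup (Fin 2) ℂ)} (hU0 : ∀ ω, U 0 ω = x)
    (hU : (latticeLangevinDynamics (fundamentalLatticeRep 2) β').IsSolution (fundamentalRep (Fin 2)) hW.natFiltration P W U)
    (hUj : Measurable (Function.uncurry U))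
    {f : (Edge 3 L × Fin 2 × Fin 2 × Bool → ℝ) → ℝ} (hf : ContDiff ℝ 5 f) (Λ : Finset (Edge 3 L)) {ℓ : Edge 3 L → ℝ} (hℓ : ∀ e, 0 ≤ ℓ e)
    (hℓΛ : ∀ e, e ∉ Λ → ℓ e = 0) {M : ℝ} {T : ℝ} (hT : 0 < T) :
    let coords : GaugeConfig 3 L (Matrix.specialUnitaryGroup (Fin 2) ℂ) → (Edge 3 L × Fin 2 × Fin 2 × Bool → ℝ) :=
      fun V q => (fun z : ℂ => if q.2.2.2 then z.im else z.re)
        ((fundamentalRep (Fin 2) (V q.1) : Matrix (Fin 2) (Fin 2) ℂ) q.2.1 q.2.2.1)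
    (∀ (e : Edge 3 L) (y y' : (GaugeConfig 3 L (Matrix.specialUnitaryGroup (Fin 2) ℂ))), (∀ g, g ≠ e → y g = y' g) →
      |f (coords y) - f (coords y')| ≤ ℓ e * frobNorm ((y e : Matrix (Fin 2) (Fin 2) ℂ) - (y' e : Matrix (Fin 2) (Fin 2) ℂ))) →
    (∀ y : (GaugeConfig 3 L (Matrix.specialUnitaryGroup (Fin 2) ℂ)), |f (coords y)| ≤ M) →
    ∫ ω, (T⁻¹ * (∫ r in Ioc 0 T, f (coords (U r.toNNReal ω))) - ∫ y, f (coords y) ∂(wilsonMeasure (d := 3) (L := L) (fundamentalRep (Fin 2)) β')) ^ 2 ∂P ≤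
      8 * M * (12 * Real.pi * Λ.card * Real.sqrt (∑ e : Edge 3 L, ℓ e ^ 2) * (6 * (7 + 6 * ((1300 + 4 * Real.sqrt 2) * |β'|) / (1 - 12 * |β'|)) ^ 3 + 2)) /
        ((1 - 12 * |β'|) * T) := by
  intro coords hLip hM
  classical
  haveI := secondCountableTopology_su2
  haveI := borelSpace_config L
  haveI : IsProbabilityMeasure (wilsonMeasure (d := 3) (L := L) (fundamentalRep (Fin 2)) β') :=
    isProbabilityMeasure_wilsonMeasure (d := 3) (L := L) (fundamentalRep (Fin 2)) (continuous_fundamentalRep (Fin 2)) β'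
  set Cf : ℝ := 12 * Real.pi * Λ.card * Real.sqrt (∑ e : Edge 3 L, ℓ e ^ 2) * (6 * (7 + 6 * ((1300 + 4 * Real.sqrt 2) * |β'|) / (1 - 12 * |β'|)) ^ 3 + 2) with hCf
  set ρ : ℝ := 1 - 12 * |β'| with hρ
  have hρ0 : 0 < ρ := by rw [hρ]; linarith
  have hCf0 : 0 ≤ Cf := by
    rw [hCf]
    have h7 : 0 ≤ 7 + 6 * ((1300 + 4 * Real.sqrt 2) * |β'|) / (1 - 12 * |β'|) := by positivity
    positivity
  set m : ℝ := ∫ y, f (coords y) ∂(wilsonMeasure (d := 3) (L := L) (fundamentalRep (Fin 2)) β') with hm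
  have hco : Continuous coords := continuous_coords (L := L)
  have hGc : Continuous fun y : (GaugeConfig 3 L (Matrix.specialUnitaryGroup (Fin 2) ℂ)) => f (coords y) := hf.continuous.comp hco
  have hGm : Measurable fun y : (GaugeConfig 3 L (Matrix.specialUnitaryGroup (Fin 2) ℂ)) => f (coords y) := hGc.measurable
  have hM0 : 0 ≤ M := (abs_nonneg _).trans (hM x)
  have hm1 : |m| ≤ M := by
    have hh := norm_integral_le_of_norm_le_const (μ := wilsonMeasure (d := 3) (L := L) (fundamentalRep (Fin 2)) β')
      (f := fun y => f (coords y)) (C := M) (Eventually.of_forall fun y => by simpa [Real.norm_eq_abs] using hM y)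
    simpa [Real.norm_eq_abs] using hh
  -- the centred field
  set g : ℝ → Ω → ℝ := fun r ω => f (coords (U r.toNNReal ω)) - m with hgdef
  have hgm : Measurable (Function.uncurry g) := by
    have h1 : Measurable fun q : ℝ × Ω => U q.1.toNNReal q.2 :=
      hUj.comp ((measurable_real_toNNReal.comp measurable_fst).prodMk measurable_snd)
    exact (hGm.comp h1).sub measurable_const
  have hFb : ∀ z : (GaugeConfig 3 L (Matrix.specialUnitaryGroup (Fin 2) ℂ)), |f (coords z) - m| ≤ 2 * M := fun z =>
    (abs_sub _ _).trans (by linarith [hM z, hm1])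
  have hgb : ∀ r ω, |g r ω| ≤ 2 * M := fun r ω => hFb _
  -- two-time decay, volume-free
  have hord : ∀ r r' : ℝ, 0 ≤ r → r ≤ r' → |∫ ω, g r ω * g r' ω ∂P| ≤ 2 * M * Cf * Real.exp (-(ρ / 2) * |r' - r|) := by
    intro r r' hr hrr'
    have ht : r'.toNNReal = r.toNNReal + (r' - r).toNNReal := by
      rw [← Real.toNNReal_add hr (sub_nonneg.2 hrr')]; congr 1; ring
    have h1 := abs_twoTime_centered_le_uniform_of_linkLipschitz L β' hβ x hW hU0 hU (hGm.sub measurable_const) hFb hf Λ hℓ hℓΛ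
      r.toNNReal (r' - r).toNNReal hLip
    rw [← ht, Real.coe_toNNReal _ (sub_nonneg.2 hrr')] at h1
    rw [abs_of_nonneg (sub_nonneg.2 hrr')]
    have heq : ∫ ω, g r ω * g r' ω ∂P = ∫ ω, (f (coords (U r.toNNReal ω)) - m) * (f (coords (U r'.toNNReal ω)) - m) ∂P := rfl
    rw [heq]
    refine h1.trans (le_of_eq ?_)
    rw [hCf, hρ]; ring_nf
  have hdec : ∀ r ∈ Ioc 0 T, ∀ r' ∈ Ioc 0 T, |∫ ω, g r ω * g r' ω ∂P| ≤ 2 * M * Cf * Real.exp (-(ρ / 2) * |r' - r|) := by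
    intro r hr r' hr'
    rcases le_total r r' with hle | hle
    · exact hord r r' hr.1.le hle
    · have hs := hord r' r hr'.1.le hle
      have hcomm : ∫ ω, g r ω * g r' ω ∂P = ∫ ω, g r' ω * g r ω ∂P := integral_congr_ae (ae_of_all _ fun ω => mul_comm _ _)
      rw [hcomm, abs_sub_comm]
      exact hs
  have hvar := integral_sq_timeAverage_le_of_twoTime hgm hgb hT (by positivity : (0 : ℝ) ≤ 2 * M * Cf) (half_pos hρ0) hdec
  -- centring of the time average
  haveI : IsFiniteMeasure (volume.restrict (Ioc (0 : ℝ) T)) := isFiniteMeasure_restrict.2 measure_Ioc_lt_top.ne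
  have hcent : ∀ ω, T⁻¹ * (∫ r in Ioc 0 T, f (coords (U r.toNNReal ω))) - m = T⁻¹ * ∫ r in Ioc 0 T, g r ω := by
    intro ω
    have hUr : Measurable fun r : ℝ => U r.toNNReal ω := hUj.comp (measurable_real_toNNReal.prodMk measurable_const)
    have hGi : Integrable (fun r : ℝ => f (coords (U r.toNNReal ω))) (volume.restrict (Ioc 0 T)) :=
      (integrable_const M).mono' (hGm.comp hUr).aestronglyMeasurable
        (Eventually.of_forall fun r => by simpa [Real.norm_eq_abs] using hM (U r.toNNReal ω))
    have hsub : ∫ r in Ioc 0 T, g r ω = (∫ r in Ioc 0 T, f (coords (U r.toNNReal ω))) - T * m := by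
      show ∫ r in Ioc 0 T, (f (coords (U r.toNNReal ω)) - m) = _
      rw [integral_sub hGi (integrable_const m), integral_const, smul_eq_mul, measureReal_restrict_apply_univ,
        Real.volume_real_Ioc_of_le hT.le, sub_zero]
    rw [hsub, mul_sub, ← mul_assoc, inv_mul_cancel₀ hT.ne', one_mul]
  calc ∫ ω, (T⁻¹ * (∫ r in Ioc 0 T, f (coords (U r.toNNReal ω))) - m) ^ 2 ∂P = ∫ ω, (T⁻¹ * ∫ r in Ioc 0 T, g r ω) ^ 2 ∂P :=
        integral_congr_ae (ae_of_all _ fun ω => by simp only [hcent ω])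
    _ ≤ 2 * (2 * M * Cf) / (ρ / 2 * T) := hvar
    _ = 8 * M * Cf / (ρ * T) := by
        field_simp
        ring

end Summit.QuantumFields.YangMills.Theorems.ColdStartUniversality.LiebRobinson

end
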